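import Summits.BirchSwinnertonDyer.BirchSwinnertonDyer.Theorems.SylvesterTwoHeegnerIndexCoupledTelescopeFlipCore
import Summits.BirchSwinnertonDyer.BirchSwinnertonDyer.Theorems.SylvesterTwoHeegnerIndexCMDataClassInvariance
import Literature.NumberTheory.EllipticCurves.HuShuYin2019.SylvesterPairGoodPlaces
import HarnessLib

/-!
# The COUPLED Cassels–Tate telescope, XXVIII: THE TWO FLIPS WITH MULTIPLES for the HSY pair at a general
# level `9p(ℓm)` and the torsion level `2^M` (RESIDUE c v3 (T-L1), l.87–92 and l.93–98)

Crux `UpperOffV0HSYPlus` (stmt-BirchSwinnertonDyer-19804); rows' display RESIDUE c v3 (`…TailFourOfResidue`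
p714972).  The core `SylvesterTwoCMFlip.flip_core_sylvesterTower` (`…CoupledTelescopeFlipCore`) in its two
HSY orientations, for the coupled frame of #R-g (`exists_coupledFrame`: cube roots `v_B³ = p/9`,
`v_A³ = p²/3`, transports `ψ_B`, `ψ_A`, ONE CM family `ρ` with `ρ_B = ρ`, `ρ_A = ρ ∘ ρ`, twist laws):
* ★ `flip_upperA_sylvesterTower` — l.87–92: `k • c_A(ℓm)` Selmer at `λ ∋ ℓ` iff `k • c_B(m) ∈ T_B(λ)`
  (`(E_{b₁}, E_{b₂}) = (A, B) = (E_{3p²}, E_p)`, upper family `ρ ∘ ρ`, lower family `ρ = (ρ∘ρ)∘(ρ∘ρ)` by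
  `ρ³ = 1`, #R-h `rho_rho_rho_eq`);
* ★ `flip_upperB_sylvesterTower` — l.93–98: `k • c_B(ℓm)` Selmer at `λ` iff `k • c_A(m) ∈ T_A(λ)`
  (`(E_{b₁}, E_{b₂}) = (B, A)`, upper family `ρ`, lower family `ρ ∘ ρ`).
The curve-specific inputs of the core are discharged here: ellipticity (`isElliptic_cubeSumCurve_baseChange`), good
reduction of `A_K`, `B_K` at `λ` (k-ty1 #11 `hasGoodReductionAt_cubeSumCurve_{three_mul_sq,prime}_baseChange`),
`N'` (the `K[9p]`-fixer) fixing `v_A`, `v_B` (#R-c `forall_apply_eq_of_pow_three_eq_{sq_div_three,div_nine}_of_fix_nine_mul`).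
What stays displayed (hypotheses, exactly as in the level-`2` files `flip_levelPrime` / `flip_levelPair`): the
points `z, z₀ ∈ W₀(K[9p(ℓm)])` with `htrz` ((ES1) through `D_m`) and `hES` ((ES2) through `D_m`), `hPmFrob`,
`hsel₂`, `hP₁ hP₂ hA₁ hA₂`, and the Kolyvagin clauses of `ℓ` for the LOWER curve (`ℓ ∤ N`, `Frob_ℓ = Frob_∞`
on the `2^M`-torsion — the rows' `Kol ℓ` carries both for both curves).
Theorems only (no definition / named fact / instance / notation); nothing asserted on 19804; no stub closed;
X12.CMAtTwo NOT proved; BSD not claimed for any curve.  Sources: [GrossLMS1991] §3 (3.5), Prop. 3.7, §4,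
Prop. 6.2 (2); [McCallumLMS1991] Prop. 4.4, §4 (4)–(6); [Nekovar2007] Prop. 4.9, 4.13; [HuShuYin2019] §1–§2, §4.1.
`lean search 'flip_upper'` → nothing before this file.
-/

set_option linter.dupNamespace false -- Summits modules are `Summit.<Summit>.<Problem>…` by design
set_option autoImplicit false

noncomputable section

open scoped Classical Pointwise

namespace Summit.BirchSwinnertonDyer.BirchSwinnertonDyer.Theorems.SylvesterTwoCMFlip

open WeierstrassCurve Field NumberField IsDedekindDomain Finset
open Literature.NumberTheory.EllipticCurves Literature.NumberTheory.GaloisRepresentations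
  Literature.NumberTheory.EllipticCurves.ModularForms
  Literature.NumberTheory.EllipticCurves.HuShuYin2019
  Literature.NumberTheory.EllipticCurves.KolyvaginCocycle
  Summit.BirchSwinnertonDyer.BirchSwinnertonDyer.Theorems.SylvesterTwoCMData
  Summit.BirchSwinnertonDyer.Rank1Residual.X11b
  Summit.BirchSwinnertonDyer.Rank1Residual.X11b.RingClassTower

variable {K : Type} [Field K] [NumberField K]

/-- ★ **FLIP 1 (RESIDUE c v3 l.87–92): `k • c_A(ℓm)` is Selmer at `λ ∋ ℓ` iff `k • c_B(m) ∈ T_B(λ)`** — the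
core in the orientation `(E_{b₁}, E_{b₂}) = (A_K, B_K) = (E_{3p²}, E_p)` (upper family `ρ ∘ ρ`, lower family `ρ`),
for the classes of `ψ_A (κ⁻¹ ι D_σ z)^{χ_A}` and `ψ_B (κ⁻¹ ι z₀)^{χ_B}` at the torsion level `nl = 2^M`, GRANTED
the displayed inputs (module docstring). [cite: GrossLMS1991, §3 (3.5), Prop. 3.7, Prop. 6.2 (2), §4]
[cite: McCallumLMS1991, Prop. 4.4, §4 (4)–(6)] [cite: HuShuYin2019, §1 p. 4, §2 Prop. 2.4, §4.1]
[cite: Nekovar2007, Prop. 4.9, Prop. 4.13 (ii)] -/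
theorem flip_upperA_sylvesterTower {ω : K} (hω : ω ^ 2 + ω + 1 = 0) (h2 : Module.finrank ℚ K = 2)
    (ι : K →+* ℂ) [(⟨0, 0, 1, 0, -1⟩ : WeierstrassCurve ℚ).IsElliptic] [(⟨0, 0, 1, 0, -1⟩ : WeierstrassCurve ℚ).IsGloballyMinimal]
    {p ℓ m : ℕ} (hp : p.Prime) (hp3 : p % 3 = 1) [Fact ℓ.Prime] (hℓ3 : ℓ % 3 = 2) (hℓ2 : ℓ ≠ 2)
    (hℓp : ¬ ℓ ∣ p) (hm : m ≠ 0) (hℓm : ¬ ℓ ∣ m)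
    (hℓB : ¬ ℓ ∣ (cubeSumCurve (p : ℚ)).conductorNorm ℤ) (hℓdK : ¬ ((ℓ : ℤ) ∣ NumberField.discr K))
    {M : ℕ} (hM : 1 ≤ M) (nl : ℕ) (hn : nl = 2 ^ M) (hFrobB : FrobEqFrobInfty (cubeSumCurve (p : ℚ)) K nl ℓ)
    (hΔ : ¬ (ℓ : ℤ) ∣ minimalDiscriminantInt (⟨0, 0, 1, 0, -1⟩ : WeierstrassCurve ℚ))
    -- the frame transport `E₉(K̄) ≃+ W₀(K̄)`
    (κ : geomPoints ((cubeSumCurve 9).baseChange K) ≃+ geomPoints ((⟨0, 0, 1, 0, -1⟩ : WeierstrassCurve ℚ).baseChange K))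
    (hκG : ∀ (g : absoluteGaloisGroup K) (P : geomPoints ((cubeSumCurve 9).baseChange K)), κ (g • P) = g • κ P)
    {a b d : AlgebraicClosure K}
    (hκ : ∀ {x y : AlgebraicClosure K}
      (h : (((cubeSumCurve 9).baseChange K).baseChange (AlgebraicClosure K)).toAffine.Nonsingular x y),
      ∃ h', κ (.some x y h) = .some (a * x) (b * y + d) h')
    -- the coupled frame (#R-g `exists_coupledFrame`)
    {vB vA : AlgebraicClosure K} (hvBc : vB ^ 3 = algebraMap ℚ (AlgebraicClosure K) ((p : ℚ) / 9))
    (hvB : vB ≠ 0) (hvAc : vA ^ 3 = algebraMap ℚ (AlgebraicClosure K) ((p : ℚ) ^ 2 / 3)) (hvA0 : vA ≠ 0)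
    (hvB3 : ∀ g : absoluteGaloisGroup K, ((show AlgebraicClosure K ≃ₐ[K] AlgebraicClosure K from g) vB) ^ 3 = vB ^ 3)
    (hvA3 : ∀ g : absoluteGaloisGroup K, ((show AlgebraicClosure K ≃ₐ[K] AlgebraicClosure K from g) vA) ^ 3 = vA ^ 3)
    {ψB : geomPoints ((cubeSumCurve 9).baseChange K) ≃+ geomPoints ((cubeSumCurve (p : ℚ)).baseChange K)}
    {ψA : geomPoints ((cubeSumCurve 9).baseChange K) ≃+ geomPoints ((cubeSumCurve (3 * (p : ℚ) ^ 2)).baseChange K)}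
    (hψB : ∀ {x y : AlgebraicClosure K}
      (h : (((cubeSumCurve 9).baseChange K).baseChange (AlgebraicClosure K)).toAffine.Nonsingular x y),
      ∃ h', ψB (Affine.Point.some x y h) = Affine.Point.some (vB ^ 2 * x) (vB ^ 3 * y) h')
    (hψA : ∀ {x y : AlgebraicClosure K}
      (h : (((cubeSumCurve 9).baseChange K).baseChange (AlgebraicClosure K)).toAffine.Nonsingular x y),
      ∃ h', ψA (Affine.Point.some x y h) = Affine.Point.some (vA ^ 2 * x) (vA ^ 3 * y) h')
    {ρ : absoluteGaloisGroup K → geomPoints ((cubeSumCurve 9).baseChange K) ≃+ geomPoints ((cubeSumCurve 9).baseChange K)}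
    (hρ : ∀ (g : absoluteGaloisGroup K) {x y : AlgebraicClosure K}
        (h : (((cubeSumCurve 9).baseChange K).baseChange (AlgebraicClosure K)).toAffine.Nonsingular x y),
        ∃ h', ρ g (Affine.Point.some x y h) =
          Affine.Point.some (((show AlgebraicClosure K ≃ₐ[K] AlgebraicClosure K from g) vB / vB) ^ 2 * x) y h')
    (hρρ : ∀ (g : absoluteGaloisGroup K) {x y : AlgebraicClosure K}
        (h : (((cubeSumCurve 9).baseChange K).baseChange (AlgebraicClosure K)).toAffine.Nonsingular x y),
        ∃ h', ρ g (ρ g (Affine.Point.some x y h)) =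
          Affine.Point.some (((show AlgebraicClosure K ≃ₐ[K] AlgebraicClosure K from g) vA / vA) ^ 2 * x) y h')
    (hlawB : ∀ (g : absoluteGaloisGroup K) (P : geomPoints ((cubeSumCurve 9).baseChange K)), g • ψB P = ψB (ρ g (g • P)))
    (hρcomm : ∀ (g h : absoluteGaloisGroup K) (P : geomPoints ((cubeSumCurve 9).baseChange K)), h • ρ g P = ρ g (h • P))
    -- the level `K[9p(ℓm)]`: embedding, fixer, the `K[9p]`-fixer, representatives
    (emb : ringClassField K ι (9 * p * (ℓ * m)) →+* AlgebraicClosure K)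
    (hemb : ∀ k : K, emb (algebraMap K (ringClassField K ι (9 * p * (ℓ * m))) k) = algebraMap K (AlgebraicClosure K) k)
    (ιe : letI : DecidableEq (ringClassField K ι (9 * p * (ℓ * m))) := fun a b ↦ Classical.propDecidable (a = b)
      ((⟨0, 0, 1, 0, -1⟩ : WeierstrassCurve ℚ).baseChange (ringClassField K ι (9 * p * (ℓ * m)))).toAffine.Point →+ geomPoints ((⟨0, 0, 1, 0, -1⟩ : WeierstrassCurve ℚ).baseChange K))
    (hιe : ∀ P, ιe P = Affine.Point.map (W' := (⟨0, 0, 1, 0, -1⟩ : WeierstrassCurve ℚ)) emb.toRatAlgHom P)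
    (N : Subgroup (absoluteGaloisGroup K))
    (hN : ∀ g : absoluteGaloisGroup K, g ∈ N ↔ ∀ x : ringClassField K ι (9 * p * (ℓ * m)), (show AlgebraicClosure K ≃ₐ[K] AlgebraicClosure K from g) (emb x) = emb x)
    (N' : Subgroup (absoluteGaloisGroup K))
    (hN' : ∀ g : absoluteGaloisGroup K, g ∈ N' ↔
      ∀ x ∈ {x : ringClassField K ι (9 * p * (ℓ * m)) | (x : ℂ) ∈ ringClassField K ι (9 * p)}, (show AlgebraicClosure K ≃ₐ[K] AlgebraicClosure K from g) (emb x) = emb x)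
    {ιt : Type} [Fintype ιt] (t : ιt → absoluteGaloisGroup K)
    -- the generator of `Gal(K[9p(ℓm)]/K[9pm])`, the two points and their Euler-system inputs
    {σ : ringClassField K ι (9 * p * (ℓ * m)) ≃ₐ[ℚ] ringClassField K ι (9 * p * (ℓ * m))}
    (hσ : Subgroup.zpowers σ = ringClassGalOver ι (9 * p * (ℓ * m)) (9 * p * m))
    {z z₀ : ((⟨0, 0, 1, 0, -1⟩ : WeierstrassCurve ℚ).baseChange (ringClassField K ι (9 * p * (ℓ * m)))).toAffine.Point}
    (htrz : ∑ i ∈ Finset.range (ℓ + 1), pointGalHom (⟨0, 0, 1, 0, -1⟩ : WeierstrassCurve ℚ) (ringClassField K ι (9 * p * (ℓ * m))) (σ ^ i) z = 0)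
    (hES : ∀ (φ₀ : absoluteGaloisGroup (ZMod ℓ)), (∀ x : AlgebraicClosure (ZMod ℓ), φ₀ • x = x ^ ℓ) →
      ∀ g : absoluteGaloisGroup K,
        geomReduction hΔ ((RatClosure.pointsEquiv (K := K) (⟨0, 0, 1, 0, -1⟩ : WeierstrassCurve ℚ)).symm (g • ιe z)) =
          φ₀ • geomReduction hΔ ((RatClosure.pointsEquiv (K := K) (⟨0, 0, 1, 0, -1⟩ : WeierstrassCurve ℚ)).symm (g • ιe z₀)))
    -- the classes' admissibility / invariance inputs
    {hdivA : ∀ P : geomPoints ((cubeSumCurve (3 * (p : ℚ) ^ 2)).baseChange K), ∃ R : geomPoints ((cubeSumCurve (3 * (p : ℚ) ^ 2)).baseChange K), ((nl : ℕ) : ℤ) • R = P}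
    {hdivB : ∀ P : geomPoints ((cubeSumCurve (p : ℚ)).baseChange K), ∃ R : geomPoints ((cubeSumCurve (p : ℚ)).baseChange K), ((nl : ℕ) : ℤ) • R = P}
    (hAA : IsAdmissible (absoluteGaloisGroup K)
      ((FixedPoints.addSubgroup N (geomPoints ((cubeSumCurve 9).baseChange K))).map ψA.toAddMonoidHom) ((nl : ℕ) : ℤ))
    (hAB : IsAdmissible (absoluteGaloisGroup K)
      ((FixedPoints.addSubgroup N (geomPoints ((cubeSumCurve 9).baseChange K))).map ψB.toAddMonoidHom) ((nl : ℕ) : ℤ))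
    (hP₁ : ψA (∑ i, ρ (t i) (ρ (t i) (t i • κ.symm (ιe (KolyvaginOperator.derivOp (pointGalHom (⟨0, 0, 1, 0, -1⟩ : WeierstrassCurve ℚ) (ringClassField K ι (9 * p * (ℓ * m)))) σ ℓ z))))) ∈
      invPoints (absoluteGaloisGroup K) ((FixedPoints.addSubgroup N (geomPoints ((cubeSumCurve 9).baseChange K))).map ψA.toAddMonoidHom) ((nl : ℕ) : ℤ))
    (hP₂ : ψB (∑ i, ρ (t i) (t i • κ.symm (ιe z₀))) ∈
      invPoints (absoluteGaloisGroup K) ((FixedPoints.addSubgroup N (geomPoints ((cubeSumCurve 9).baseChange K))).map ψB.toAddMonoidHom) ((nl : ℕ) : ℤ))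
    -- the place and the displayed inputs about `κ⁻¹ ι z₀` at `λ`
    (v : HeightOneSpectrum (𝓞 K)) (hv : (ℓ : 𝓞 K) ∈ v.asIdeal)
    (hPmFrob : ∀ 𝔓 ∈ v.primesAbove, ∀ F : absoluteGaloisGroup K, IsArithFrobAt (𝓞 K) F 𝔓 → F • κ.symm (ιe z₀) = κ.symm (ιe z₀))
    (hsel₂ : kolyvaginClass ((cubeSumCurve (p : ℚ)).baseChange K) ((nl : ℕ) : ℤ) hdivB hAB (ψB (∑ i, ρ (t i) (t i • κ.symm (ιe z₀)))) hP₂ ∈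
      selmerLocalKer ((cubeSumCurve (p : ℚ)).baseChange K) (v.adicCompletion K) ((nl : ℕ) : ℤ))
    (k : ℤ) :
    k • kolyvaginClass ((cubeSumCurve (3 * (p : ℚ) ^ 2)).baseChange K) ((nl : ℕ) : ℤ) hdivA hAA
        (ψA (∑ i, ρ (t i) (ρ (t i) (t i • κ.symm (ιe (KolyvaginOperator.derivOp (pointGalHom (⟨0, 0, 1, 0, -1⟩ : WeierstrassCurve ℚ) (ringClassField K ι (9 * p * (ℓ * m)))) σ ℓ z)))))) hP₁ ∈
        selmerLocalKer ((cubeSumCurve (3 * (p : ℚ) ^ 2)).baseChange K) (v.adicCompletion K) ((nl : ℕ) : ℤ) ↔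
      k • kolyvaginClass ((cubeSumCurve (p : ℚ)).baseChange K) ((nl : ℕ) : ℤ) hdivB hAB
          (ψB (∑ i, ρ (t i) (t i • κ.symm (ιe z₀)))) hP₂ ∈
        ((cubeSumCurve (p : ℚ)).baseChange K).torsionLocalKer (v.adicCompletion K) ((nl : ℕ) : ℤ) := by
  have hℓ : ℓ.Prime := Fact.out
  have hp0 : p ≠ 0 := hp.ne_zero
  have hp0' : (p : ℚ) ≠ 0 := by exact_mod_cast hp0
  have hp2 : p ≠ 2 := by rintro rfl; norm_num at hp3
  have hℓ3' : ℓ ≠ 3 := by rintro rfl; simp at hℓ3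
  haveI hBell : ((cubeSumCurve (p : ℚ)).baseChange K).IsElliptic := isElliptic_cubeSumCurve_baseChange K hp0'
  haveI hAell : ((cubeSumCurve (3 * (p : ℚ) ^ 2)).baseChange K).IsElliptic := isElliptic_cubeSumCurve_baseChange K (by positivity)
  haveI hBellQ : (cubeSumCurve (p : ℚ)).IsElliptic := by
    have h := isElliptic_cubeSumCurve_baseChange ℚ hp0'
    rwa [WeierstrassCurve.baseChange, Algebra.algebraMap_self, WeierstrassCurve.map_id] at h
  have hℓm0 : ℓ * m ≠ 0 := mul_ne_zero hℓ.ne_zero hm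
  have hN'vB : ∀ h ∈ N', (show AlgebraicClosure K ≃ₐ[K] AlgebraicClosure K from h) vB = vB := fun h hh ↦
    forall_apply_eq_of_pow_three_eq_div_nine_of_fix_nine_mul hω h2 ι hp0 hℓm0 emb hemb N' hN' h hh vB hvBc
  have hN'vA : ∀ h ∈ N', (show AlgebraicClosure K ≃ₐ[K] AlgebraicClosure K from h) vA = vA := fun h hh ↦
    forall_apply_eq_of_pow_three_eq_sq_div_three_of_fix_nine_mul hω h2 ι hp0 hℓm0 emb hemb N' hN' h hh vA hvAc
  have h3v : ((3 : ℕ) : 𝓞 K) ∉ v.asIdeal := not_natCast_mem_of_prime_ne hℓ Nat.prime_three hℓ3' v hv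
  have hpv : ((p : ℕ) : 𝓞 K) ∉ v.asIdeal :=
    not_natCast_mem_of_prime_ne hℓ hp (fun h ↦ hℓp (h ▸ dvd_rfl)) v hv
  have hgoodA := hasGoodReductionAt_cubeSumCurve_three_mul_sq_baseChange (K := K) hp hp2 v h3v hpv
  have hgoodB := hasGoodReductionAt_cubeSumCurve_prime_baseChange (K := K) hp hp2 v h3v hpv
  have hρρ' : ∀ (g : absoluteGaloisGroup K) {x y : AlgebraicClosure K}
      (h : (((cubeSumCurve 9).baseChange K).baseChange (AlgebraicClosure K)).toAffine.Nonsingular x y),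
      ∃ h', (fun g ↦ (ρ g).trans (ρ g)) g (Affine.Point.some x y h) =
        Affine.Point.some (((show AlgebraicClosure K ≃ₐ[K] AlgebraicClosure K from g) vA / vA) ^ 2 * x) y h' := fun g x y h ↦ hρρ g h
  -- `ρ = (ρ∘ρ)∘(ρ∘ρ)` (`ρ³ = 1`) and the commutation of `ρ∘ρ` with `Γ_K`
  have hρ' : ∀ (g : absoluteGaloisGroup K) (x : geomPoints ((cubeSumCurve 9).baseChange K)),
      ρ g x = (fun g ↦ (ρ g).trans (ρ g)) g ((fun g ↦ (ρ g).trans (ρ g)) g x) := fun g x ↦ by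
    change ρ g x = ρ g (ρ g (ρ g (ρ g x)))
    rw [rho_rho_rho_eq hvB hvB3 hρ g (ρ g x)]
  have hρρcomm : ∀ (g h : absoluteGaloisGroup K) (x : geomPoints ((cubeSumCurve 9).baseChange K)),
      h • (fun g ↦ (ρ g).trans (ρ g)) g x = (fun g ↦ (ρ g).trans (ρ g)) g (h • x) := fun g h x ↦ by
    change h • ρ g (ρ g x) = ρ g (ρ g (h • x))
    rw [hρcomm, hρcomm]
  exact flip_core_sylvesterTower hω h2 ι hp hℓ3 hℓ2 hℓp hm hℓm hℓB hℓdK hM nl hn hFrobB hΔ κ hκG hκ hvA0 hvB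
    hvA3 hvB3 hψA hψB (ρ := fun g ↦ (ρ g).trans (ρ g)) (ρ' := ρ) hρρ' hρ hρ' hlawB hρρcomm emb hemb ιe hιe
    N hN N' hN' hN'vA hN'vB t hσ htrz hES (hdiv₁ := hdivA) (hdiv₂ := hdivB) hAA hAB hP₁ hP₂ v hv hgoodA
    hgoodB hPmFrob hsel₂ k

/-- ★ **FLIP 2 (RESIDUE c v3 l.93–98): `k • c_B(ℓm)` is Selmer at `λ ∋ ℓ` iff `k • c_A(m) ∈ T_A(λ)`** — the
core in the orientation `(E_{b₁}, E_{b₂}) = (B_K, A_K) = (E_p, E_{3p²})` (upper family `ρ`, lower family `ρ ∘ ρ`),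
for the classes of `ψ_B (κ⁻¹ ι D_σ z)^{χ_B}` and `ψ_A (κ⁻¹ ι z₀)^{χ_A}` at the torsion level `nl = 2^M`, GRANTED
the displayed inputs (module docstring). [cite: GrossLMS1991, §3 (3.5), Prop. 3.7, Prop. 6.2 (2), §4]
[cite: McCallumLMS1991, Prop. 4.4, §4 (4)–(6)] [cite: HuShuYin2019, §1 p. 4, §2 Prop. 2.4, §4.1]
[cite: Nekovar2007, Prop. 4.9, Prop. 4.13 (ii)] -/
theorem flip_upperB_sylvesterTower {ω : K} (hω : ω ^ 2 + ω + 1 = 0) (h2 : Module.finrank ℚ K = 2)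
    (ι : K →+* ℂ) [(⟨0, 0, 1, 0, -1⟩ : WeierstrassCurve ℚ).IsElliptic] [(⟨0, 0, 1, 0, -1⟩ : WeierstrassCurve ℚ).IsGloballyMinimal]
    {p ℓ m : ℕ} (hp : p.Prime) (hp3 : p % 3 = 1) [Fact ℓ.Prime] (hℓ3 : ℓ % 3 = 2) (hℓ2 : ℓ ≠ 2)
    (hℓp : ¬ ℓ ∣ p) (hm : m ≠ 0) (hℓm : ¬ ℓ ∣ m)
    (hℓA : ¬ ℓ ∣ (cubeSumCurve (3 * (p : ℚ) ^ 2)).conductorNorm ℤ) (hℓdK : ¬ ((ℓ : ℤ) ∣ NumberField.discr K))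
    {M : ℕ} (hM : 1 ≤ M) (nl : ℕ) (hn : nl = 2 ^ M) (hFrobA : FrobEqFrobInfty (cubeSumCurve (3 * (p : ℚ) ^ 2)) K nl ℓ)
    (hΔ : ¬ (ℓ : ℤ) ∣ minimalDiscriminantInt (⟨0, 0, 1, 0, -1⟩ : WeierstrassCurve ℚ))
    -- the frame transport `E₉(K̄) ≃+ W₀(K̄)`
    (κ : geomPoints ((cubeSumCurve 9).baseChange K) ≃+ geomPoints ((⟨0, 0, 1, 0, -1⟩ : WeierstrassCurve ℚ).baseChange K))
    (hκG : ∀ (g : absoluteGaloisGroup K) (P : geomPoints ((cubeSumCurve 9).baseChange K)), κ (g • P) = g • κ P)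
    {a b d : AlgebraicClosure K}
    (hκ : ∀ {x y : AlgebraicClosure K}
      (h : (((cubeSumCurve 9).baseChange K).baseChange (AlgebraicClosure K)).toAffine.Nonsingular x y),
      ∃ h', κ (.some x y h) = .some (a * x) (b * y + d) h')
    -- the coupled frame (#R-g `exists_coupledFrame`)
    {vB vA : AlgebraicClosure K} (hvBc : vB ^ 3 = algebraMap ℚ (AlgebraicClosure K) ((p : ℚ) / 9))
    (hvB : vB ≠ 0) (hvAc : vA ^ 3 = algebraMap ℚ (AlgebraicClosure K) ((p : ℚ) ^ 2 / 3)) (hvA0 : vA ≠ 0)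
    (hvB3 : ∀ g : absoluteGaloisGroup K, ((show AlgebraicClosure K ≃ₐ[K] AlgebraicClosure K from g) vB) ^ 3 = vB ^ 3)
    (hvA3 : ∀ g : absoluteGaloisGroup K, ((show AlgebraicClosure K ≃ₐ[K] AlgebraicClosure K from g) vA) ^ 3 = vA ^ 3)
    {ψB : geomPoints ((cubeSumCurve 9).baseChange K) ≃+ geomPoints ((cubeSumCurve (p : ℚ)).baseChange K)}
    {ψA : geomPoints ((cubeSumCurve 9).baseChange K) ≃+ geomPoints ((cubeSumCurve (3 * (p : ℚ) ^ 2)).baseChange K)}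
    (hψB : ∀ {x y : AlgebraicClosure K}
      (h : (((cubeSumCurve 9).baseChange K).baseChange (AlgebraicClosure K)).toAffine.Nonsingular x y),
      ∃ h', ψB (Affine.Point.some x y h) = Affine.Point.some (vB ^ 2 * x) (vB ^ 3 * y) h')
    (hψA : ∀ {x y : AlgebraicClosure K}
      (h : (((cubeSumCurve 9).baseChange K).baseChange (AlgebraicClosure K)).toAffine.Nonsingular x y),
      ∃ h', ψA (Affine.Point.some x y h) = Affine.Point.some (vA ^ 2 * x) (vA ^ 3 * y) h')
    {ρ : absoluteGaloisGroup K → geomPoints ((cubeSumCurve 9).baseChange K) ≃+ geomPoints ((cubeSumCurve 9).baseChange K)}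
    (hρ : ∀ (g : absoluteGaloisGroup K) {x y : AlgebraicClosure K}
        (h : (((cubeSumCurve 9).baseChange K).baseChange (AlgebraicClosure K)).toAffine.Nonsingular x y),
        ∃ h', ρ g (Affine.Point.some x y h) =
          Affine.Point.some (((show AlgebraicClosure K ≃ₐ[K] AlgebraicClosure K from g) vB / vB) ^ 2 * x) y h')
    (hρρ : ∀ (g : absoluteGaloisGroup K) {x y : AlgebraicClosure K}
        (h : (((cubeSumCurve 9).baseChange K).baseChange (AlgebraicClosure K)).toAffine.Nonsingular x y),
        ∃ h', ρ g (ρ g (Affine.Point.some x y h)) =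
          Affine.Point.some (((show AlgebraicClosure K ≃ₐ[K] AlgebraicClosure K from g) vA / vA) ^ 2 * x) y h')
    (hlawA : ∀ (g : absoluteGaloisGroup K) (P : geomPoints ((cubeSumCurve 9).baseChange K)), g • ψA P = ψA (ρ g (ρ g (g • P))))
    (hρcomm : ∀ (g h : absoluteGaloisGroup K) (P : geomPoints ((cubeSumCurve 9).baseChange K)), h • ρ g P = ρ g (h • P))
    -- the level `K[9p(ℓm)]`: embedding, fixer, the `K[9p]`-fixer, representatives
    (emb : ringClassField K ι (9 * p * (ℓ * m)) →+* AlgebraicClosure K)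
    (hemb : ∀ k : K, emb (algebraMap K (ringClassField K ι (9 * p * (ℓ * m))) k) = algebraMap K (AlgebraicClosure K) k)
    (ιe : letI : DecidableEq (ringClassField K ι (9 * p * (ℓ * m))) := fun a b ↦ Classical.propDecidable (a = b)
      ((⟨0, 0, 1, 0, -1⟩ : WeierstrassCurve ℚ).baseChange (ringClassField K ι (9 * p * (ℓ * m)))).toAffine.Point →+ geomPoints ((⟨0, 0, 1, 0, -1⟩ : WeierstrassCurve ℚ).baseChange K))
    (hιe : ∀ P, ιe P = Affine.Point.map (W' := (⟨0, 0, 1, 0, -1⟩ : WeierstrassCurve ℚ)) emb.toRatAlgHom P)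
    (N : Subgroup (absoluteGaloisGroup K))
    (hN : ∀ g : absoluteGaloisGroup K, g ∈ N ↔ ∀ x : ringClassField K ι (9 * p * (ℓ * m)), (show AlgebraicClosure K ≃ₐ[K] AlgebraicClosure K from g) (emb x) = emb x)
    (N' : Subgroup (absoluteGaloisGroup K))
    (hN' : ∀ g : absoluteGaloisGroup K, g ∈ N' ↔
      ∀ x ∈ {x : ringClassField K ι (9 * p * (ℓ * m)) | (x : ℂ) ∈ ringClassField K ι (9 * p)}, (show AlgebraicClosure K ≃ₐ[K] AlgebraicClosure K from g) (emb x) = emb x)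
    {ιt : Type} [Fintype ιt] (t : ιt → absoluteGaloisGroup K)
    -- the generator of `Gal(K[9p(ℓm)]/K[9pm])`, the two points and their Euler-system inputs
    {σ : ringClassField K ι (9 * p * (ℓ * m)) ≃ₐ[ℚ] ringClassField K ι (9 * p * (ℓ * m))}
    (hσ : Subgroup.zpowers σ = ringClassGalOver ι (9 * p * (ℓ * m)) (9 * p * m))
    {z z₀ : ((⟨0, 0, 1, 0, -1⟩ : WeierstrassCurve ℚ).baseChange (ringClassField K ι (9 * p * (ℓ * m)))).toAffine.Point}
    (htrz : ∑ i ∈ Finset.range (ℓ + 1), pointGalHom (⟨0, 0, 1, 0, -1⟩ : WeierstrassCurve ℚ) (ringClassField K ι (9 * p * (ℓ * m))) (σ ^ i) z = 0)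
    (hES : ∀ (φ₀ : absoluteGaloisGroup (ZMod ℓ)), (∀ x : AlgebraicClosure (ZMod ℓ), φ₀ • x = x ^ ℓ) →
      ∀ g : absoluteGaloisGroup K,
        geomReduction hΔ ((RatClosure.pointsEquiv (K := K) (⟨0, 0, 1, 0, -1⟩ : WeierstrassCurve ℚ)).symm (g • ιe z)) =
          φ₀ • geomReduction hΔ ((RatClosure.pointsEquiv (K := K) (⟨0, 0, 1, 0, -1⟩ : WeierstrassCurve ℚ)).symm (g • ιe z₀)))
    -- the classes' admissibility / invariance inputs
    {hdivA : ∀ P : geomPoints ((cubeSumCurve (3 * (p : ℚ) ^ 2)).baseChange K), ∃ R : geomPoints ((cubeSumCurve (3 * (p : ℚ) ^ 2)).baseChange K), ((nl : ℕ) : ℤ) • R = P}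
    {hdivB : ∀ P : geomPoints ((cubeSumCurve (p : ℚ)).baseChange K), ∃ R : geomPoints ((cubeSumCurve (p : ℚ)).baseChange K), ((nl : ℕ) : ℤ) • R = P}
    (hAA : IsAdmissible (absoluteGaloisGroup K)
      ((FixedPoints.addSubgroup N (geomPoints ((cubeSumCurve 9).baseChange K))).map ψA.toAddMonoidHom) ((nl : ℕ) : ℤ))
    (hAB : IsAdmissible (absoluteGaloisGroup K)
      ((FixedPoints.addSubgroup N (geomPoints ((cubeSumCurve 9).baseChange K))).map ψB.toAddMonoidHom) ((nl : ℕ) : ℤ))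
    (hP₁ : ψB (∑ i, ρ (t i) (t i • κ.symm (ιe (KolyvaginOperator.derivOp (pointGalHom (⟨0, 0, 1, 0, -1⟩ : WeierstrassCurve ℚ) (ringClassField K ι (9 * p * (ℓ * m)))) σ ℓ z)))) ∈
      invPoints (absoluteGaloisGroup K) ((FixedPoints.addSubgroup N (geomPoints ((cubeSumCurve 9).baseChange K))).map ψB.toAddMonoidHom) ((nl : ℕ) : ℤ))
    (hP₂ : ψA (∑ i, ρ (t i) (ρ (t i) (t i • κ.symm (ιe z₀)))) ∈
      invPoints (absoluteGaloisGroup K) ((FixedPoints.addSubgroup N (geomPoints ((cubeSumCurve 9).baseChange K))).map ψA.toAddMonoidHom) ((nl : ℕ) : ℤ))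
    -- the place and the displayed inputs about `κ⁻¹ ι z₀` at `λ`
    (v : HeightOneSpectrum (𝓞 K)) (hv : (ℓ : 𝓞 K) ∈ v.asIdeal)
    (hPmFrob : ∀ 𝔓 ∈ v.primesAbove, ∀ F : absoluteGaloisGroup K, IsArithFrobAt (𝓞 K) F 𝔓 → F • κ.symm (ιe z₀) = κ.symm (ιe z₀))
    (hsel₂ : kolyvaginClass ((cubeSumCurve (3 * (p : ℚ) ^ 2)).baseChange K) ((nl : ℕ) : ℤ) hdivA hAA (ψA (∑ i, ρ (t i) (ρ (t i) (t i • κ.symm (ιe z₀))))) hP₂ ∈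
      selmerLocalKer ((cubeSumCurve (3 * (p : ℚ) ^ 2)).baseChange K) (v.adicCompletion K) ((nl : ℕ) : ℤ))
    (k : ℤ) :
    k • kolyvaginClass ((cubeSumCurve (p : ℚ)).baseChange K) ((nl : ℕ) : ℤ) hdivB hAB
        (ψB (∑ i, ρ (t i) (t i • κ.symm (ιe (KolyvaginOperator.derivOp (pointGalHom (⟨0, 0, 1, 0, -1⟩ : WeierstrassCurve ℚ) (ringClassField K ι (9 * p * (ℓ * m)))) σ ℓ z))))) hP₁ ∈
        selmerLocalKer ((cubeSumCurve (p : ℚ)).baseChange K) (v.adicCompletion K) ((nl : ℕ) : ℤ) ↔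
      k • kolyvaginClass ((cubeSumCurve (3 * (p : ℚ) ^ 2)).baseChange K) ((nl : ℕ) : ℤ) hdivA hAA
          (ψA (∑ i, ρ (t i) (ρ (t i) (t i • κ.symm (ιe z₀))))) hP₂ ∈
        ((cubeSumCurve (3 * (p : ℚ) ^ 2)).baseChange K).torsionLocalKer (v.adicCompletion K) ((nl : ℕ) : ℤ) := by
  have hℓ : ℓ.Prime := Fact.out
  have hp0 : p ≠ 0 := hp.ne_zero
  have hp0' : (p : ℚ) ≠ 0 := by exact_mod_cast hp0
  have hp2 : p ≠ 2 := by rintro rfl; norm_num at hp3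
  have hℓ3' : ℓ ≠ 3 := by rintro rfl; simp at hℓ3
  haveI hBell : ((cubeSumCurve (p : ℚ)).baseChange K).IsElliptic := isElliptic_cubeSumCurve_baseChange K hp0'
  haveI hAell : ((cubeSumCurve (3 * (p : ℚ) ^ 2)).baseChange K).IsElliptic := isElliptic_cubeSumCurve_baseChange K (by positivity)
  haveI hAellQ : (cubeSumCurve (3 * (p : ℚ) ^ 2)).IsElliptic := by
    have h := isElliptic_cubeSumCurve_baseChange ℚ (show (3 * (p : ℚ) ^ 2) ≠ 0 by positivity)
    rwa [WeierstrassCurve.baseChange, Algebra.algebraMap_self, WeierstrassCurve.map_id] at h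
  have hℓm0 : ℓ * m ≠ 0 := mul_ne_zero hℓ.ne_zero hm
  have hN'vB : ∀ h ∈ N', (show AlgebraicClosure K ≃ₐ[K] AlgebraicClosure K from h) vB = vB := fun h hh ↦
    forall_apply_eq_of_pow_three_eq_div_nine_of_fix_nine_mul hω h2 ι hp0 hℓm0 emb hemb N' hN' h hh vB hvBc
  have hN'vA : ∀ h ∈ N', (show AlgebraicClosure K ≃ₐ[K] AlgebraicClosure K from h) vA = vA := fun h hh ↦
    forall_apply_eq_of_pow_three_eq_sq_div_three_of_fix_nine_mul hω h2 ι hp0 hℓm0 emb hemb N' hN' h hh vA hvAc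
  have h3v : ((3 : ℕ) : 𝓞 K) ∉ v.asIdeal := not_natCast_mem_of_prime_ne hℓ Nat.prime_three hℓ3' v hv
  have hpv : ((p : ℕ) : 𝓞 K) ∉ v.asIdeal :=
    not_natCast_mem_of_prime_ne hℓ hp (fun h ↦ hℓp (h ▸ dvd_rfl)) v hv
  have hgoodA := hasGoodReductionAt_cubeSumCurve_three_mul_sq_baseChange (K := K) hp hp2 v h3v hpv
  have hgoodB := hasGoodReductionAt_cubeSumCurve_prime_baseChange (K := K) hp hp2 v h3v hpv
  have hρρ' : ∀ (g : absoluteGaloisGroup K) {x y : AlgebraicClosure K}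
      (h : (((cubeSumCurve 9).baseChange K).baseChange (AlgebraicClosure K)).toAffine.Nonsingular x y),
      ∃ h', (fun g ↦ (ρ g).trans (ρ g)) g (Affine.Point.some x y h) =
        Affine.Point.some (((show AlgebraicClosure K ≃ₐ[K] AlgebraicClosure K from g) vA / vA) ^ 2 * x) y h' := fun g x y h ↦ hρρ g h
  have hρ' : ∀ (g : absoluteGaloisGroup K) (x : geomPoints ((cubeSumCurve 9).baseChange K)),
      (fun g ↦ (ρ g).trans (ρ g)) g x = ρ g (ρ g x) := fun g x ↦ rfl
  have hlawA' : ∀ (g : absoluteGaloisGroup K) (P : geomPoints ((cubeSumCurve 9).baseChange K)),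
      g • ψA P = ψA ((fun g ↦ (ρ g).trans (ρ g)) g (g • P)) := fun g P ↦ hlawA g P
  exact flip_core_sylvesterTower hω h2 ι hp hℓ3 hℓ2 hℓp hm hℓm hℓA hℓdK hM nl hn hFrobA hΔ κ hκG hκ hvB hvA0
    hvB3 hvA3 hψB hψA (ρ := ρ) (ρ' := fun g ↦ (ρ g).trans (ρ g)) hρ hρρ' hρ' hlawA' hρcomm emb hemb ιe hιe
    N hN N' hN' hN'vB hN'vA t hσ htrz hES (hdiv₁ := hdivB) (hdiv₂ := hdivA) hAB hAA hP₁ hP₂ v hv hgoodB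
    hgoodA hPmFrob hsel₂ k

end Summit.BirchSwinnertonDyer.BirchSwinnertonDyer.Theorems.SylvesterTwoCMFlip

end
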